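import Mathlib
import Summits.NavierStokesRegularity.OSWSelfSimilar.SheetHalfLineVelocityPairing
import HarnessLib

/-!
# Viscous gCLM/OSW profile MODEL, NS-type line: the SIGN-FREE TAIL-SIGN LAW `sgn A = −sgn a`
# and the sign-free exclusions «no fast tail for a ≠ 0», «no eventually-signed profile of the wrong sign»

HONEST FRAMING (cell ns-blowup GROUP B «PROFILE SEARCH», zone Z3 = the 1-D viscous gCLM/OSW sheet; human rulings
D-0035/D-0074): **1-D MODEL; not Euler, not Navier–Stokes; «violates: none — MODEL».** Nothing here is a statement about NS.

SETTING (= the profile class of `SheetNSLineMomentSignLaw`, NO SIGN HYPOTHESIS): `Ω` odd, `C²` (`Ω′ = dOm`, `Ω″ = ddOm`),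
`|Ω′| ≤ M`, `|Ω(ξ)| ≤ C/(1+ξ²)`; MODEL velocity `𝒰` (`𝒰′ = HΩ` with the genuine `hilbertTransform`, `𝒰(0) = 0`); the sheet
equation `F₁(c_ω, c_ω/2, a, b = 1, ε, HΩ, 𝒰, Ω) ≡ 0` on `(0,∞)` (NS-type line `c_l = c_ω/2`, ANY `ε`, ANY gauge); decay class
`𝒰Ω, ξ(HΩ)Ω ∈ L¹(0,∞)`, `ξ𝒰Ω → 0`, `ξΩ′ → 0`. INPUTS: the TAIL LAW `(c_ω/2)·ξ²Ω(ξ) → a∫₀^∞𝒰Ω` (`nsTypeLine_tail_law`, p540197)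
and the SIGN-FREE PAIRING LAW `∫₀^∞𝒰Ω ≤ 0`, `= 0 ⇔ Ω ≡ 0` (`SheetHalfLineVelocityPairing`).

WHAT IS KERNEL-CHECKED HERE (all new here — MODEL):
* `integral_Ioi_velocity_mul_neg` — `Ω ≢ 0 ⇒ ∫₀^∞𝒰Ω < 0`.
* `nsTypeLine_tail_pos_of_a_neg` / `nsTypeLine_tail_neg_of_a_pos_signFree` — **TAIL-SIGN LAW: for EVERY nontrivial profile,
  `A := lim ξ²Ω = (2a/c_ω)∫₀^∞𝒰Ω` has `sgn A = −sgn a`** (`a < 0` ⇒ POSITIVE `ξ⁻²` tail, `a > 0` ⇒ NEGATIVE `ξ⁻²` tail; with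
  `nsTypeLine_tail_zero_of_a_eq_zero`: `a = 0` ⇒ NO `ξ⁻²` tail). The E½ branch (`a > 0`, `A = −21.8178(1)` at `a = 0.2`) is on
  the predicted side; `nsTypeLine_tail_neg_of_a_pos` (E-signed) is the special case.
* `nsTypeLine_trivial_of_integrable_id_mul` — **for `a ≠ 0` there is NO nontrivial NS-type-line profile with `ξΩ ∈ L¹(0,∞)`**:
  every profile has an EXACT `ξ⁻²` tail (`A ≠ 0`), nothing decays faster (any sign structure).
* `nsTypeLine_empty_of_a_neg_of_eventually_nonpos` — **for `a < 0` (blow-up `c_ω > 0`) there is NO nontrivial profile that is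
  `≤ 0` near `+∞`** — this CONTAINS the E-signed exclusion `nsTypeLine_ESigned_empty_of_a_neg` (p540197, `Ω ≤ 0` on all of
  `(0,∞)`) and says: an `a < 0` NS-type-line profile, if any, changes sign and ends with a POSITIVE `ξ⁻²` tail;
  `nsTypeLine_empty_of_a_pos_of_eventually_nonneg` — the mirror statement for `a > 0`.
Reading for CENSUS-Z3 row Z3-E12⁻ clause (i′) (steady half): the kernel exclusion for `a < 0` on the NS-type line no longer needs
Chen's class-3 sign condition globally — only the sign of the far tail decides, and it is forced to be positive.
NOT PROVED HERE: existence/non-existence of sign-changing `a < 0` profiles with a positive tail; anything dynamic; profiles outside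
the decay class; anything about Euler or NS.
bears_on: LADDER-NS N5 / zone Z3 clause (i′) (CENSUS-Z3 v2.11 §0) → N1 linear core; SELFSIM-NOGO M7/M8 MODEL side.
-/

noncomputable section
open Set Filter Topology MeasureTheory
open scoped Real

namespace Summit.NavierStokesRegularity.OSWSelfSimilar
namespace SheetHalfLine
open HouLuoOriginLaws (F1)
open Literature.Analysis.Fourier

/-- **`Ω ≢ 0 ⇒ ∫₀^∞ 𝒰Ω < 0`** (sign-free pairing law + strictness). [new here — MODEL] -/
theorem integral_Ioi_velocity_mul_neg {Om dOm U : ℝ → ℝ} {M C : ℝ} (hodd : ∀ y, Om (-y) = -Om y)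
    (hOm : ∀ ξ, HasDerivAt Om (dOm ξ) ξ) (hdOmc : Continuous dOm) (hM : ∀ y, |dOm y| ≤ M)
    (hC : ∀ y, |Om y| ≤ C / (1 + y ^ 2))
    (hU : ∀ ξ, HasDerivAt U (hilbertTransform Om ξ) ξ) (hU0 : U 0 = 0) (hne : Om ≠ 0) :
    ∫ x in Ioi (0:ℝ), U x * Om x < 0 := by
  rcases lt_or_eq_of_le (integral_Ioi_velocity_mul_nonpos hodd hOm hdOmc hM hC hU hU0) with h | h
  · exact h
  · exact absurd (eq_zero_of_integral_Ioi_velocity_mul_eq_zero hodd hOm hdOmc hM hC hU hU0 h) hne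

/-! ### The tail-sign law -/

/-- **TAIL-SIGN LAW, `a < 0`: a NONTRIVIAL NS-type-line profile has a POSITIVE `ξ⁻²` tail** —
`(c_ω/2)·ξ²Ω(ξ) → a∫₀^∞𝒰Ω > 0`; no sign hypothesis on `Ω`. [new here — MODEL] -/
theorem nsTypeLine_tail_pos_of_a_neg (cω a ε M C : ℝ) (U Om dOm ddOm : ℝ → ℝ) (ha : a < 0)
    (hodd : ∀ y, Om (-y) = -Om y)
    (hOm : ∀ ξ, HasDerivAt Om (dOm ξ) ξ) (hdOm : ∀ ξ, HasDerivAt dOm (ddOm ξ) ξ)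
    (hM : ∀ y, |dOm y| ≤ M) (hC : ∀ y, |Om y| ≤ C / (1 + y ^ 2))
    (hU : ∀ ξ, HasDerivAt U (hilbertTransform Om ξ) ξ) (hU0 : U 0 = 0)
    (hF : ∀ ξ ∈ Ioi (0:ℝ), F1 cω (cω / 2) a 1 ε (hilbertTransform Om) U Om dOm ddOm (fun _ => 0) ξ = 0)
    (iUOm : IntegrableOn (fun ξ => U ξ * Om ξ) (Ioi 0))
    (iH : IntegrableOn (fun ξ => ξ * (hilbertTransform Om ξ * Om ξ)) (Ioi 0))
    (hUOm : Tendsto (fun R => R * U R * Om R) atTop (𝓝 0))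
    (hdOm1 : Tendsto (fun R => R * dOm R) atTop (𝓝 0)) (hne : Om ≠ 0) :
    Tendsto (fun R => cω / 2 * (R ^ 2 * Om R)) atTop (𝓝 (a * ∫ ξ in Ioi (0:ℝ), U ξ * Om ξ))
      ∧ 0 < a * ∫ ξ in Ioi (0:ℝ), U ξ * Om ξ := by
  have hdOmc : Continuous dOm := continuous_iff_continuousAt.mpr fun x => (hdOm x).continuousAt
  exact ⟨nsTypeLine_tail_law cω a ε M C U Om dOm ddOm hodd hOm hdOm hM hC hU hF iUOm iH hUOm hdOm1,
    mul_pos_of_neg_of_neg ha (integral_Ioi_velocity_mul_neg hodd hOm hdOmc hM hC hU hU0 hne)⟩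

/-- **TAIL-SIGN LAW, `a > 0`: a NONTRIVIAL NS-type-line profile has a NEGATIVE `ξ⁻²` tail** —
`(c_ω/2)·ξ²Ω(ξ) → a∫₀^∞𝒰Ω < 0`; no sign hypothesis on `Ω` (the sign-free form of `nsTypeLine_tail_neg_of_a_pos`).
[new here — MODEL] -/
theorem nsTypeLine_tail_neg_of_a_pos_signFree (cω a ε M C : ℝ) (U Om dOm ddOm : ℝ → ℝ) (ha : 0 < a)
    (hodd : ∀ y, Om (-y) = -Om y)
    (hOm : ∀ ξ, HasDerivAt Om (dOm ξ) ξ) (hdOm : ∀ ξ, HasDerivAt dOm (ddOm ξ) ξ)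
    (hM : ∀ y, |dOm y| ≤ M) (hC : ∀ y, |Om y| ≤ C / (1 + y ^ 2))
    (hU : ∀ ξ, HasDerivAt U (hilbertTransform Om ξ) ξ) (hU0 : U 0 = 0)
    (hF : ∀ ξ ∈ Ioi (0:ℝ), F1 cω (cω / 2) a 1 ε (hilbertTransform Om) U Om dOm ddOm (fun _ => 0) ξ = 0)
    (iUOm : IntegrableOn (fun ξ => U ξ * Om ξ) (Ioi 0))
    (iH : IntegrableOn (fun ξ => ξ * (hilbertTransform Om ξ * Om ξ)) (Ioi 0))
    (hUOm : Tendsto (fun R => R * U R * Om R) atTop (𝓝 0))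
    (hdOm1 : Tendsto (fun R => R * dOm R) atTop (𝓝 0)) (hne : Om ≠ 0) :
    Tendsto (fun R => cω / 2 * (R ^ 2 * Om R)) atTop (𝓝 (a * ∫ ξ in Ioi (0:ℝ), U ξ * Om ξ))
      ∧ a * ∫ ξ in Ioi (0:ℝ), U ξ * Om ξ < 0 := by
  have hdOmc : Continuous dOm := continuous_iff_continuousAt.mpr fun x => (hdOm x).continuousAt
  exact ⟨nsTypeLine_tail_law cω a ε M C U Om dOm ddOm hodd hOm hdOm hM hC hU hF iUOm iH hUOm hdOm1,
    mul_neg_of_pos_of_neg ha (integral_Ioi_velocity_mul_neg hodd hOm hdOmc hM hC hU hU0 hne)⟩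

/-! ### Sign-free exclusions on the NS-type line -/

/-- If `R²Ω(R) → L ≠ 0` then `ξΩ(ξ) ∉ L¹(0,∞)` (comparison with `|L|/(2ξ)` on a tail `(R₀,∞)`). [folklore] -/
theorem not_integrableOn_id_mul_of_tendsto_sq_mul {Om : ℝ → ℝ} {L : ℝ} (hL : L ≠ 0)
    (hlim : Tendsto (fun R => R ^ 2 * Om R) atTop (𝓝 L)) :
    ¬ IntegrableOn (fun ξ => ξ * Om ξ) (Ioi 0) := by
  intro hint
  have hLpos : 0 < |L| / 2 := by positivity
  -- eventually |R²Ω(R)| ≥ |L|/2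
  have hev : ∀ᶠ R in atTop, |L| / 2 ≤ |R ^ 2 * Om R| := by
    have h := (hlim.sub_const L).abs  -- |R²Ω − L| → 0
    rw [sub_self, abs_zero] at h
    filter_upwards [h.eventually (gt_mem_nhds hLpos)] with R hR
    have := abs_sub_abs_le_abs_sub L (R ^ 2 * Om R)
    rw [abs_sub_comm] at this
    linarith
  obtain ⟨R₀, hR₀⟩ := (hev.and (eventually_ge_atTop 1)).exists_forall_of_atTop
  -- on (R₀, ∞): |L|/2 · ξ⁻¹ ≤ |ξΩ(ξ)|, so ξ⁻¹ would be integrable there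
  have hR₀1 : ∀ ξ, R₀ ≤ ξ → 1 ≤ ξ := fun ξ hξ => (hR₀ ξ hξ).2
  have hdom : IntegrableOn (fun ξ : ℝ => |L| / 2 * ξ⁻¹) (Ioi R₀) := by
    refine Integrable.mono' (hint.mono_set (Ioi_subset_Ioi ?_)).norm
      ((measurable_const.mul measurable_inv).aestronglyMeasurable) ?_
    · have := hR₀1 R₀ le_rfl; linarith
    · refine (ae_restrict_iff' measurableSet_Ioi).mpr (Eventually.of_forall fun ξ hξ => ?_)
      have hξ' : R₀ ≤ ξ := le_of_lt hξ
      have hξ0 : 0 < ξ := lt_of_lt_of_le one_pos (hR₀1 ξ hξ')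
      have hb := (hR₀ ξ hξ').1
      rw [Real.norm_eq_abs, abs_of_pos (by positivity : (0:ℝ) < |L| / 2 * ξ⁻¹), Real.norm_eq_abs]
      rw [abs_mul, abs_of_pos (pow_pos hξ0 2)] at hb
      rw [abs_mul, abs_of_pos hξ0]
      calc |L| / 2 * ξ⁻¹ ≤ ξ ^ 2 * |Om ξ| * ξ⁻¹ := mul_le_mul_of_nonneg_right hb (inv_nonneg.mpr hξ0.le)
        _ = ξ * |Om ξ| := by field_simp
  have hinv : IntegrableOn (fun ξ : ℝ => ξ⁻¹) (Ioi R₀) := by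
    have h := hdom.const_mul (2 / |L|)
    refine h.congr (Eventually.of_forall fun ξ => ?_)
    have : |L| ≠ 0 := abs_ne_zero.mpr hL
    field_simp
  exact not_integrableOn_Ioi_inv hinv

/-- **For `a ≠ 0` NO nontrivial NS-type-line profile has `ξΩ ∈ L¹(0,∞)`** (blow-up `c_ω ≠ 0`, any `ε`, ANY SIGN STRUCTURE):
every profile has the exact tail `Ω ~ Aξ⁻²` with `A = (2a/c_ω)∫₀^∞𝒰Ω ≠ 0`. [new here — MODEL] -/
theorem nsTypeLine_trivial_of_integrable_id_mul (cω a ε M C : ℝ) (U Om dOm ddOm : ℝ → ℝ) (hcω : cω ≠ 0) (ha : a ≠ 0)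
    (hodd : ∀ y, Om (-y) = -Om y)
    (hOm : ∀ ξ, HasDerivAt Om (dOm ξ) ξ) (hdOm : ∀ ξ, HasDerivAt dOm (ddOm ξ) ξ)
    (hM : ∀ y, |dOm y| ≤ M) (hC : ∀ y, |Om y| ≤ C / (1 + y ^ 2))
    (hU : ∀ ξ, HasDerivAt U (hilbertTransform Om ξ) ξ) (hU0 : U 0 = 0)
    (hF : ∀ ξ ∈ Ioi (0:ℝ), F1 cω (cω / 2) a 1 ε (hilbertTransform Om) U Om dOm ddOm (fun _ => 0) ξ = 0)
    (iUOm : IntegrableOn (fun ξ => U ξ * Om ξ) (Ioi 0))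
    (iH : IntegrableOn (fun ξ => ξ * (hilbertTransform Om ξ * Om ξ)) (Ioi 0))
    (hUOm : Tendsto (fun R => R * U R * Om R) atTop (𝓝 0))
    (hdOm1 : Tendsto (fun R => R * dOm R) atTop (𝓝 0))
    (hint : IntegrableOn (fun ξ => ξ * Om ξ) (Ioi 0)) : Om = 0 := by
  by_contra hne
  have hdOmc : Continuous dOm := continuous_iff_continuousAt.mpr fun x => (hdOm x).continuousAt
  have hlim := nsTypeLine_tail_law cω a ε M C U Om dOm ddOm hodd hOm hdOm hM hC hU hF iUOm iH hUOm hdOm1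
  have hJ : ∫ ξ in Ioi (0:ℝ), U ξ * Om ξ ≠ 0 :=
    (integral_Ioi_velocity_mul_neg hodd hOm hdOmc hM hC hU hU0 hne).ne
  -- R²Ω(R) → (2/c_ω)·a∫𝒰Ω ≠ 0
  have hlim' : Tendsto (fun R => R ^ 2 * Om R) atTop (𝓝 ((cω / 2)⁻¹ * (a * ∫ ξ in Ioi (0:ℝ), U ξ * Om ξ))) := by
    have h := hlim.const_mul (cω / 2)⁻¹
    refine h.congr' (Eventually.of_forall fun R => ?_)
    field_simp
  have hL : (cω / 2)⁻¹ * (a * ∫ ξ in Ioi (0:ℝ), U ξ * Om ξ) ≠ 0 :=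
    mul_ne_zero (inv_ne_zero (div_ne_zero hcω two_ne_zero)) (mul_ne_zero ha hJ)
  exact not_integrableOn_id_mul_of_tendsto_sq_mul hL hlim' hint

/-- **For `a < 0` (blow-up `c_ω > 0`, any `ε`) the NS-type line carries NO nontrivial profile that is `≤ 0` near `+∞`** —
sign-free strengthening of the census decl `nsTypeLine_ESigned_empty_of_a_neg` (there `Ω ≤ 0` on all of `(0,∞)`): a
nontrivial profile would have a POSITIVE `ξ⁻²` tail. [new here — MODEL] -/
theorem nsTypeLine_empty_of_a_neg_of_eventually_nonpos (cω a ε M C : ℝ) (U Om dOm ddOm : ℝ → ℝ) (hcω : 0 < cω)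
    (ha : a < 0) (hodd : ∀ y, Om (-y) = -Om y)
    (hOm : ∀ ξ, HasDerivAt Om (dOm ξ) ξ) (hdOm : ∀ ξ, HasDerivAt dOm (ddOm ξ) ξ)
    (hM : ∀ y, |dOm y| ≤ M) (hC : ∀ y, |Om y| ≤ C / (1 + y ^ 2))
    (hU : ∀ ξ, HasDerivAt U (hilbertTransform Om ξ) ξ) (hU0 : U 0 = 0)
    (hF : ∀ ξ ∈ Ioi (0:ℝ), F1 cω (cω / 2) a 1 ε (hilbertTransform Om) U Om dOm ddOm (fun _ => 0) ξ = 0)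
    (iUOm : IntegrableOn (fun ξ => U ξ * Om ξ) (Ioi 0))
    (iH : IntegrableOn (fun ξ => ξ * (hilbertTransform Om ξ * Om ξ)) (Ioi 0))
    (hUOm : Tendsto (fun R => R * U R * Om R) atTop (𝓝 0))
    (hdOm1 : Tendsto (fun R => R * dOm R) atTop (𝓝 0))
    (hev : ∀ᶠ ξ in atTop, Om ξ ≤ 0) : Om = 0 := by
  by_contra hne
  obtain ⟨hlim, hpos⟩ := nsTypeLine_tail_pos_of_a_neg cω a ε M C U Om dOm ddOm ha hodd hOm hdOm hM hC hU hU0 hF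
    iUOm iH hUOm hdOm1 hne
  have hev' : ∀ᶠ R in atTop, 0 < cω / 2 * (R ^ 2 * Om R) := hlim.eventually (lt_mem_nhds hpos)
  obtain ⟨R, hR1, hR2⟩ := (hev'.and hev).exists
  have h2 : 0 < R ^ 2 * Om R := (mul_pos_iff_of_pos_left (by positivity : (0:ℝ) < cω / 2)).mp hR1
  have h3 : R ^ 2 * Om R ≤ 0 := mul_nonpos_of_nonneg_of_nonpos (sq_nonneg R) hR2
  linarith

/-- **For `a > 0` (blow-up `c_ω > 0`, any `ε`) the NS-type line carries NO nontrivial profile that is `≥ 0` near `+∞`**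
(the mirror statement: a nontrivial `a > 0` profile has a NEGATIVE `ξ⁻²` tail, as E½ does). [new here — MODEL] -/
theorem nsTypeLine_empty_of_a_pos_of_eventually_nonneg (cω a ε M C : ℝ) (U Om dOm ddOm : ℝ → ℝ) (hcω : 0 < cω)
    (ha : 0 < a) (hodd : ∀ y, Om (-y) = -Om y)
    (hOm : ∀ ξ, HasDerivAt Om (dOm ξ) ξ) (hdOm : ∀ ξ, HasDerivAt dOm (ddOm ξ) ξ)
    (hM : ∀ y, |dOm y| ≤ M) (hC : ∀ y, |Om y| ≤ C / (1 + y ^ 2))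
    (hU : ∀ ξ, HasDerivAt U (hilbertTransform Om ξ) ξ) (hU0 : U 0 = 0)
    (hF : ∀ ξ ∈ Ioi (0:ℝ), F1 cω (cω / 2) a 1 ε (hilbertTransform Om) U Om dOm ddOm (fun _ => 0) ξ = 0)
    (iUOm : IntegrableOn (fun ξ => U ξ * Om ξ) (Ioi 0))
    (iH : IntegrableOn (fun ξ => ξ * (hilbertTransform Om ξ * Om ξ)) (Ioi 0))
    (hUOm : Tendsto (fun R => R * U R * Om R) atTop (𝓝 0))
    (hdOm1 : Tendsto (fun R => R * dOm R) atTop (𝓝 0))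
    (hev : ∀ᶠ ξ in atTop, 0 ≤ Om ξ) : Om = 0 := by
  by_contra hne
  obtain ⟨hlim, hneg⟩ := nsTypeLine_tail_neg_of_a_pos_signFree cω a ε M C U Om dOm ddOm ha hodd hOm hdOm hM hC hU hU0
    hF iUOm iH hUOm hdOm1 hne
  have hev' : ∀ᶠ R in atTop, cω / 2 * (R ^ 2 * Om R) < 0 := hlim.eventually (gt_mem_nhds hneg)
  obtain ⟨R, hR1, hR2⟩ := (hev'.and hev).exists
  have h2 : 0 ≤ cω / 2 * (R ^ 2 * Om R) := by positivity
  linarith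

end SheetHalfLine
end Summit.NavierStokesRegularity.OSWSelfSimilar
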